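import Summits.QuantumFields.YangMills.Theorems.BalabanUVNodesN15KingModelCarriers
import Summits.QuantumFields.YangMills.Theorems.BalabanUVNodesN15KingModelFullPropagatorLaplacian
import HarnessLib

/-!
# BalabanUVNodes ∕ N15 — THE KING-MODEL RUNG, CURVED EDITION (PART Υ-a): TOOLS FOR THE SECOND-ORDER `L²` MEMBERS OF [B9] (3.46) AT `U ≡ 1`, I —
# the torus `H²` identity `Σ_x(∂_μ∂_νv)² ≤ Σ_x(Δv)²`, the product rule for the lattice Laplacian, sums block by block, and the block-by-block
# `L²`-contraction of King's `Q*Q`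
# (Track A, DAG node N15 = NE2; FAN-OUT v1.1 §N15 s3 «KING-MODEL RUNG … + the one-line statement of what the curved case adds»)

HONEST FRAMING.  Count-neutral lattice calculus (cell `pub-ymgap`, seat `pub-ymgap-dag-n15-e` g17; `--supports stmt-QuantumFields-27366 --as helper` =
K3⁸ `SpineGivenEndpointR13SepCoPHV`).  Nothing of [B9] ∕ [King1986] is asserted here: these are the ELEMENTARY tools by which part Υ-b decides the
two remaining `L²` members `‖h∇∇Gλ‖`, `‖hG∇*∇*λ‖` of [Balaban1985BackgroundPropagators] Thm 3.1 (3.46) p. 398 at `U ≡ 1` for King's full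
`A = 0` propagator `A₀⁻¹` (part Ξ-b `…FullPropagatorL2LocalMixed` HONEST SCOPE (iv) left them open: the kernels `∇_μ∇_νA₀⁻¹(·, z)` have NO
uniform sup majorant — logarithmic at the edges of the `Q*Q` blocks for `μ ≠ ν` — so Schur's test does not serve; the road is `L²` INTERIOR
REGULARITY on the torus).  The lit-balaban N06 lane proved the same two torus identities on ITS carrier `↥(boxDom N)` for Bałaban's `Δ′_a`
(`Literature/…/B9Ineq346SecondOrderTorusCore`: `sq_dT_dT_le_sq_perLapT`, `perLapT_mulVec_mul`); King's carrier is `Tor K = Π_μ ℤ∕K_μ` (a different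
type), so §1–§2 re-derive them there, in the vocabulary of dag-n15-d's `N15.KingModel.fwdDiff ∕ adjDiff ∕ lapOp` (`…N15KingModelCarriers`) — cited,
not restated.  NOT Bałaban's `G(U)`; NE2⁺ NOT PRINTED ∕ not proved; NOT a node discharge; nothing continuum ∕ ℝ⁴ ∕ OS ∕ mass-gap ∕ Clay.
0 `sorry`, 0 `def`, standard axioms.
* §1 translation-invariant sums (`sum_comp_add_torus`, `sum_comp_sub_torus`), the adjointness `Σ(∂_μf)g = Σ f(∂_μ*g)` (`sum_fwdDiff_mul`,
  `sum_adjDiff_mul`), commuting differences, `Δ = −Σ_μ∂_μ*∂_μ` (`lapOp_eq_neg_sum`), the mixed energy identity `sum_lapDir_mul_lapDir_eq`, ★★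
  **`sum_sq_fwdDiff_fwdDiff_le_sum_sq_lapOp`** (THE TORUS `H²` IDENTITY `Σ_x(∂_μ∂_νv(x))² ≤ Σ_x((Δv)(x))²`, every `v`, every `μ, ν`), `fwdDiff_fwdDiff_apply`;
* §2 ★ `lapOp_mul_apply` (`Δ(χu) = χΔu + uΔχ + Σ_μ[(χ(·+e_μ) − χ)(u(·+e_μ) − u) + (χ(·−e_μ) − χ)(u(·−e_μ) − u)]`, pointwise), `sq_sum_fin_le`, ★ `sq_lapOp_mul_le` (squared, with the scale factor `n = η⁻¹`);
* §3 `sum_eq_sum_blocks` (`Σ_x F = Σ_b Σ_{x∈b} F`), `sum_blockIndicator_eq` (`|b| = N^{d+1}`), `blockProj_mulVec_eq_mean`, ★ **`sum_block_sq_blockProj_le`**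
  (`Σ_{x∈b}((Q*Qg)(x))² ≤ Σ_{x∈b}g(x)²` — Cauchy–Schwarz on the block mean).
WHAT THE CURVED CASE ADDS (one line): nothing here — background-free tools; the covariant (3.46) is [B9]'s random-walk expansion (N06's row).
Locators: [Balaban1985BackgroundPropagators] Thm 3.1 (3.46) p. 398; [King1986] (2.13) p. 653, (4.1)–(4.5) p. 670 (`A₀`, `Q*Q`), (4.36) p. 674.
-/

noncomputable section

namespace Summit.QuantumFields.YangMills.BalabanUVNodes.N15KingModelRung.Curved

open Real Finset Matrix
open Literature.MathematicalPhysics.QuantumFieldTheory.Balaban1983to89.B5Prop11Plancherel (Tor fine unitVec)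
open Literature.MathematicalPhysics.QuantumFieldTheory.King1986.Torus (blockOf blockProj)
open Summit.QuantumFields.YangMills.BalabanUVNodes.N15.KingModel (fwdDiff adjDiff lapOp fwdDiff_apply lapOp_apply)

variable {d : ℕ}

/-! ## §1 Differences on the torus `Tor K = Π_μ ℤ∕K_μ`: translation invariance, adjointness, the `H²` identity -/

section Torus

variable (K : Fin (d + 1) → ℕ) [∀ μ, NeZero (K μ)]

omit [∀ μ, NeZero (K μ)] in
/-- Unfolding of the adjoint difference `(∂_ν*f)(x) = f(x − e_ν) − f(x)`. [folklore] -/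
theorem adjDiff_apply (ν : Fin (d + 1)) (f : Tor K → ℝ) (x : Tor K) : adjDiff K ν f x = f (x - unitVec K ν) - f x := rfl

/-- Sums over the torus are translation invariant: `Σ_x f(x + t) = Σ_x f(x)`. [folklore] -/
theorem sum_comp_add_torus (f : Tor K → ℝ) (t : Tor K) : ∑ x, f (x + t) = ∑ x, f x :=
  Fintype.sum_equiv (Equiv.addRight t) _ _ fun _ => rfl

/-- `Σ_x f(x − t) = Σ_x f(x)`. [folklore] -/
theorem sum_comp_sub_torus (f : Tor K → ℝ) (t : Tor K) : ∑ x, f (x - t) = ∑ x, f x := by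
  simpa only [Equiv.subRight_apply] using Fintype.sum_equiv (Equiv.subRight t) (fun x => f (x - t)) f fun _ => rfl

/-- **ADJOINTNESS**: `Σ_x (∂_μf)(x)·g(x) = Σ_x f(x)·(∂_μ*g)(x)` (the forward difference and `f ↦ f(· − e_μ) − f` are `ℓ²`-adjoint). [folklore] -/
theorem sum_fwdDiff_mul (μ : Fin (d + 1)) (f g : Tor K → ℝ) : ∑ x, fwdDiff K μ f x * g x = ∑ x, f x * adjDiff K μ g x := by
  simp only [fwdDiff_apply, adjDiff_apply, sub_mul, mul_sub, Finset.sum_sub_distrib]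
  congr 1
  have h := sum_comp_sub_torus K (fun x => f (x + unitVec K μ) * g x) (unitVec K μ)
  simp only [sub_add_cancel] at h
  exact h.symm

/-- The same read from the other side: `Σ_x (∂_μ*f)(x)·g(x) = Σ_x f(x)·(∂_μg)(x)`. [folklore] -/
theorem sum_adjDiff_mul (μ : Fin (d + 1)) (f g : Tor K → ℝ) : ∑ x, adjDiff K μ f x * g x = ∑ x, f x * fwdDiff K μ g x := by
  rw [show (∑ x, f x * fwdDiff K μ g x) = ∑ x, fwdDiff K μ g x * f x from Finset.sum_congr rfl fun _ _ => mul_comm _ _, sum_fwdDiff_mul]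
  exact Finset.sum_congr rfl fun _ _ => mul_comm _ _

omit [∀ μ, NeZero (K μ)] in
/-- Forward differences commute. [folklore] -/
theorem fwdDiff_fwdDiff_comm (μ ν : Fin (d + 1)) (f : Tor K → ℝ) : fwdDiff K μ (fwdDiff K ν f) = fwdDiff K ν (fwdDiff K μ f) := by
  ext x
  simp only [fwdDiff_apply, add_right_comm x (unitVec K μ) (unitVec K ν)]
  ring

omit [∀ μ, NeZero (K μ)] in
/-- A forward and an adjoint difference commute. [folklore] -/
theorem fwdDiff_adjDiff_comm (μ ν : Fin (d + 1)) (f : Tor K → ℝ) : fwdDiff K μ (adjDiff K ν f) = adjDiff K ν (fwdDiff K μ f) := by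
  ext x
  simp only [fwdDiff_apply, adjDiff_apply, add_sub_right_comm x (unitVec K μ) (unitVec K ν)]
  ring

omit [∀ μ, NeZero (K μ)] in
/-- `Δ = −Σ_μ ∂_μ*∂_μ`: `(Δf)(x) = −Σ_μ (∂_μ*(∂_μf))(x)`. [folklore] -/
theorem lapOp_eq_neg_sum (f : Tor K → ℝ) (x : Tor K) : lapOp K f x = -∑ μ, adjDiff K μ (fwdDiff K μ f) x := by
  rw [lapOp_apply, ← Finset.sum_neg_distrib]
  refine Finset.sum_congr rfl fun μ _ => ?_
  simp only [adjDiff_apply, fwdDiff_apply, sub_add_cancel]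
  ring

/-- The mixed energy identity: `Σ_x (∂_ρ*∂_ρf)(x)·(∂_σ*∂_σf)(x) = Σ_x (∂_ρ∂_σf(x))²` (two adjunctions and a commutation). [folklore] -/
theorem sum_lapDir_mul_lapDir_eq (ρ σ : Fin (d + 1)) (f : Tor K → ℝ) :
    ∑ x, adjDiff K ρ (fwdDiff K ρ f) x * adjDiff K σ (fwdDiff K σ f) x = ∑ x, (fwdDiff K ρ (fwdDiff K σ f) x) ^ 2 := by
  rw [sum_adjDiff_mul]
  have h1 : fwdDiff K ρ (adjDiff K σ (fwdDiff K σ f)) = adjDiff K σ (fwdDiff K σ (fwdDiff K ρ f)) := by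
    rw [fwdDiff_adjDiff_comm, fwdDiff_fwdDiff_comm]
  rw [h1]
  have h2 : ∑ x, fwdDiff K ρ f x * adjDiff K σ (fwdDiff K σ (fwdDiff K ρ f)) x
      = ∑ x, adjDiff K σ (fwdDiff K σ (fwdDiff K ρ f)) x * fwdDiff K ρ f x := Finset.sum_congr rfl fun _ _ => mul_comm _ _
  rw [h2, sum_adjDiff_mul, fwdDiff_fwdDiff_comm K σ ρ]
  exact Finset.sum_congr rfl fun _ _ => by ring

/-- ★★ **THE TORUS `H²` IDENTITY**: for EVERY function `v` on the torus and every pair of directions,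
`Σ_x (∂_μ∂_νv(x))² ≤ Σ_x ((Δv)(x))²` — indeed `Σ_{ρ,σ}‖∂_ρ∂_σv‖² = ‖Δv‖²` because all shifts commute (the lit-balaban N06 lane's
`B9Ineq346SecondOrderTorusCore.sq_dT_dT_le_sq_perLapT` on `↥(boxDom N)`; here on `Π_μ ℤ∕K_μ`). [folklore] -/
theorem sum_sq_fwdDiff_fwdDiff_le_sum_sq_lapOp (μ ν : Fin (d + 1)) (v : Tor K → ℝ) :
    ∑ x, (fwdDiff K μ (fwdDiff K ν v) x) ^ 2 ≤ ∑ x, (lapOp K v x) ^ 2 := by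
  have hexp : ∑ x, (lapOp K v x) ^ 2 = ∑ ρ, ∑ σ, ∑ x, (fwdDiff K ρ (fwdDiff K σ v) x) ^ 2 := by
    calc ∑ x, (lapOp K v x) ^ 2 = ∑ x, (∑ ρ, adjDiff K ρ (fwdDiff K ρ v) x) ^ 2 := by
          refine Finset.sum_congr rfl fun x _ => ?_
          rw [lapOp_eq_neg_sum, neg_sq]
      _ = ∑ x, ∑ ρ, ∑ σ, adjDiff K ρ (fwdDiff K ρ v) x * adjDiff K σ (fwdDiff K σ v) x := by
          refine Finset.sum_congr rfl fun x _ => ?_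
          rw [sq, Finset.sum_mul_sum]
      _ = ∑ ρ, ∑ σ, ∑ x, adjDiff K ρ (fwdDiff K ρ v) x * adjDiff K σ (fwdDiff K σ v) x := by
          rw [Finset.sum_comm]
          exact Finset.sum_congr rfl fun ρ _ => Finset.sum_comm
      _ = ∑ ρ, ∑ σ, ∑ x, (fwdDiff K ρ (fwdDiff K σ v) x) ^ 2 :=
          Finset.sum_congr rfl fun ρ _ => Finset.sum_congr rfl fun σ _ => sum_lapDir_mul_lapDir_eq K ρ σ v
  rw [hexp]
  have hnn : ∀ ρ σ, 0 ≤ ∑ x, (fwdDiff K ρ (fwdDiff K σ v) x) ^ 2 := fun ρ σ => Finset.sum_nonneg fun _ _ => sq_nonneg _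
  calc ∑ x, (fwdDiff K μ (fwdDiff K ν v) x) ^ 2
      ≤ ∑ σ, ∑ x, (fwdDiff K μ (fwdDiff K σ v) x) ^ 2 :=
        Finset.single_le_sum (f := fun σ => ∑ x, (fwdDiff K μ (fwdDiff K σ v) x) ^ 2) (fun σ _ => hnn μ σ) (Finset.mem_univ ν)
    _ ≤ ∑ ρ, ∑ σ, ∑ x, (fwdDiff K ρ (fwdDiff K σ v) x) ^ 2 :=
        Finset.single_le_sum (f := fun ρ => ∑ σ, ∑ x, (fwdDiff K ρ (fwdDiff K σ v) x) ^ 2)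
          (fun ρ _ => Finset.sum_nonneg fun σ _ => hnn ρ σ) (Finset.mem_univ μ)

omit [∀ μ, NeZero (K μ)] in
/-- The second forward difference written out: `∂_μ∂_νv(x) = v(x + e_μ + e_ν) − v(x + e_μ) − v(x + e_ν) + v(x)`. [folklore] -/
theorem fwdDiff_fwdDiff_apply (μ ν : Fin (d + 1)) (v : Tor K → ℝ) (x : Tor K) :
    fwdDiff K μ (fwdDiff K ν v) x = v (x + unitVec K μ + unitVec K ν) - v (x + unitVec K μ) - v (x + unitVec K ν) + v x := by
  simp only [fwdDiff_apply]
  ring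

/-! ## §2 The product rule for the lattice Laplacian -/

omit [∀ μ, NeZero (K μ)] in
/-- ★ **THE PRODUCT RULE**: `Δ(χu)(x) = χ(x)(Δu)(x) + u(x)(Δχ)(x) + Σ_μ[(χ(x+e_μ) − χ(x))(u(x+e_μ) − u(x)) + (χ(x−e_μ) − χ(x))(u(x−e_μ) − u(x))]`
(the N06 lane's `perLapT_mulVec_mul` on King's carrier, with King's sign of `Δ`). [folklore] -/
theorem lapOp_mul_apply (χ u : Tor K → ℝ) (x : Tor K) :
    lapOp K (fun z => χ z * u z) x
      = χ x * lapOp K u x + u x * lapOp K χ x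
        + ∑ μ, ((χ (x + unitVec K μ) - χ x) * (u (x + unitVec K μ) - u x)
          + (χ (x - unitVec K μ) - χ x) * (u (x - unitVec K μ) - u x)) := by
  simp only [lapOp_apply, Finset.mul_sum, ← Finset.sum_add_distrib]
  exact Finset.sum_congr rfl fun μ _ => by ring

/-- The square of a sum of `n` reals is at most `n` times the sum of squares (Cauchy–Schwarz), in the `Fin n`-indexed form used below. [folklore] -/
theorem sq_sum_fin_le (n : ℕ) (a : Fin n → ℝ) : (∑ i, a i) ^ 2 ≤ n * ∑ i, (a i) ^ 2 := by
  have h := sq_sum_le_card_mul_sum_sq (s := (Finset.univ : Finset (Fin n))) (f := a)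
  simpa only [Finset.card_univ, Fintype.card_fin] using h

omit [∀ μ, NeZero (K μ)] in
/-- ★ **THE PRODUCT RULE, SQUARED, WITH A SCALE FACTOR `n`** (`n = N = η⁻¹` downstream):
`(n²Δ(χu)(x))² ≤ 3χ(x)²(n²Δu(x))² + 3u(x)²(n²Δχ(x))² + 6(d+1)·Σ_μ[(n(χ(x+e_μ)−χ(x)))²(n(u(x+e_μ)−u(x)))² + (n(χ(x−e_μ)−χ(x)))²(n(u(x−e_μ)−u(x)))²]`
(Cauchy–Schwarz). [folklore] -/
theorem sq_lapOp_mul_le (n : ℝ) (χ u : Tor K → ℝ) (x : Tor K) :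
    (n ^ 2 * lapOp K (fun z => χ z * u z) x) ^ 2
      ≤ 3 * (χ x) ^ 2 * (n ^ 2 * lapOp K u x) ^ 2 + 3 * (u x) ^ 2 * (n ^ 2 * lapOp K χ x) ^ 2
        + 6 * (d + 1) * ∑ μ, ((n * (χ (x + unitVec K μ) - χ x)) ^ 2 * (n * (u (x + unitVec K μ) - u x)) ^ 2
          + (n * (χ (x - unitVec K μ) - χ x)) ^ 2 * (n * (u (x - unitVec K μ) - u x)) ^ 2) := by
  set A := χ x * (n ^ 2 * lapOp K u x) with hA
  set B := u x * (n ^ 2 * lapOp K χ x) with hB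
  set P : Fin (d + 1) → ℝ := fun μ => (n * (χ (x + unitVec K μ) - χ x)) * (n * (u (x + unitVec K μ) - u x)) with hP
  set Q : Fin (d + 1) → ℝ := fun μ => (n * (χ (x - unitVec K μ) - χ x)) * (n * (u (x - unitVec K μ) - u x)) with hQ
  have hexp : n ^ 2 * lapOp K (fun z => χ z * u z) x = A + B + ∑ μ, (P μ + Q μ) := by
    rw [lapOp_mul_apply, mul_add, mul_add, Finset.mul_sum, hA, hB]
    congr 1
    · ring
    · exact Finset.sum_congr rfl fun μ _ => by simp only [hP, hQ]; ring
  rw [hexp]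
  have hS : (∑ μ, (P μ + Q μ)) ^ 2 ≤ (d + 1 : ℕ) * ∑ μ, (P μ + Q μ) ^ 2 := sq_sum_fin_le (d + 1) fun μ => P μ + Q μ
  have hPQ : ∑ μ, (P μ + Q μ) ^ 2 ≤ 2 * ∑ μ, ((P μ) ^ 2 + (Q μ) ^ 2) := by
    rw [Finset.mul_sum]
    refine Finset.sum_le_sum fun μ _ => ?_
    nlinarith [sq_nonneg (P μ - Q μ)]
  have h3 : (A + B + ∑ μ, (P μ + Q μ)) ^ 2 ≤ 3 * A ^ 2 + 3 * B ^ 2 + 3 * (∑ μ, (P μ + Q μ)) ^ 2 := by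
    nlinarith [sq_nonneg (A - B), sq_nonneg (A - ∑ μ, (P μ + Q μ)), sq_nonneg (B - ∑ μ, (P μ + Q μ))]
  have hd : (0 : ℝ) ≤ (d + 1 : ℕ) := by positivity
  have hsq : ∑ μ, ((P μ) ^ 2 + (Q μ) ^ 2)
      = ∑ μ, ((n * (χ (x + unitVec K μ) - χ x)) ^ 2 * (n * (u (x + unitVec K μ) - u x)) ^ 2
          + (n * (χ (x - unitVec K μ) - χ x)) ^ 2 * (n * (u (x - unitVec K μ) - u x)) ^ 2) :=
    Finset.sum_congr rfl fun μ _ => by simp only [hP, hQ]; ring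
  have hA2 : A ^ 2 = (χ x) ^ 2 * (n ^ 2 * lapOp K u x) ^ 2 := by rw [hA]; ring
  have hB2 : B ^ 2 = (u x) ^ 2 * (n ^ 2 * lapOp K χ x) ^ 2 := by rw [hB]; ring
  calc (A + B + ∑ μ, (P μ + Q μ)) ^ 2 ≤ 3 * A ^ 2 + 3 * B ^ 2 + 3 * (∑ μ, (P μ + Q μ)) ^ 2 := h3
    _ ≤ 3 * A ^ 2 + 3 * B ^ 2 + 3 * ((d + 1 : ℕ) * (2 * ∑ μ, ((P μ) ^ 2 + (Q μ) ^ 2))) := by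
        have := mul_le_mul_of_nonneg_left hPQ hd
        nlinarith
    _ = 3 * (χ x) ^ 2 * (n ^ 2 * lapOp K u x) ^ 2 + 3 * (u x) ^ 2 * (n ^ 2 * lapOp K χ x) ^ 2
        + 6 * (d + 1) * ∑ μ, ((n * (χ (x + unitVec K μ) - χ x)) ^ 2 * (n * (u (x + unitVec K μ) - u x)) ^ 2
          + (n * (χ (x - unitVec K μ) - χ x)) ^ 2 * (n * (u (x - unitVec K μ) - u x)) ^ 2) := by
        rw [hsq, hA2, hB2]; push_cast; ring

end Torus

/-! ## §3 Sums block by block; `Q*Q` is an `L²`-contraction on every block -/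

section Blocks

variable (N : ℕ) [NeZero N] (M : Fin (d + 1) → ℕ) [∀ μ, NeZero (M μ)]

/-- A fine-torus sum is the sum of its block sums: `Σ_x F(x) = Σ_b Σ_x [B(x) = b]·F(x)`. [folklore] -/
theorem sum_eq_sum_blocks (F : Tor (fine N M) → ℝ) : ∑ x, F x = ∑ b : Tor M, ∑ x, (if blockOf N M x = b then F x else 0) := by
  rw [Finset.sum_comm]
  refine Finset.sum_congr rfl fun x _ => ?_
  rw [Finset.sum_ite_eq Finset.univ (blockOf N M x) (fun _ => F x), if_pos (Finset.mem_univ _)]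

/-- A unit block has `N^{d+1}` fine points: `Σ_x [B(x) = b] = N^{d+1}`. [folklore] -/
theorem sum_blockIndicator_eq (b : Tor M) : ∑ x : Tor (fine N M), (if blockOf N M x = b then (1 : ℝ) else 0) = (N : ℝ) ^ (d + 1) := by
  rw [sum_fine_blockOf N M (fun bb => if bb = b then (1 : ℝ) else 0), Finset.sum_ite_eq' Finset.univ b, if_pos (Finset.mem_univ _), mul_one]

/-- The block mean: at a point of block `b`, `(Q*Qg)(x) = N^{−(d+1)}·Σ_y [B(y) = b]·g(y)`. [cite: King1986, (4.36) p.674] -/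
theorem blockProj_mulVec_eq_mean (g : Tor (fine N M) → ℝ) {x : Tor (fine N M)} {b : Tor M} (hx : blockOf N M x = b) :
    (blockProj N M *ᵥ g) x = ((N : ℝ) ^ (d + 1))⁻¹ * ∑ y, (if blockOf N M y = b then g y else 0) := by
  rw [blockProj_mulVec_apply, Finset.mul_sum]
  refine Finset.sum_congr rfl fun y _ => ?_
  rw [hx]
  by_cases h : blockOf N M y = b
  · rw [if_pos h.symm, if_pos h]
  · rw [if_neg (Ne.symm h), if_neg h, zero_mul, mul_zero]

/-- ★ **`Q*Q` IS AN `L²`-CONTRACTION BLOCK BY BLOCK**: `Σ_x [B(x) = b]·((Q*Qg)(x))² ≤ Σ_x [B(x) = b]·g(x)²` (Cauchy–Schwarz on the block mean).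
[cite: King1986, (4.36) p.674] -/
theorem sum_block_sq_blockProj_le (g : Tor (fine N M) → ℝ) (b : Tor M) :
    ∑ x, (if blockOf N M x = b then ((blockProj N M *ᵥ g) x) ^ 2 else 0) ≤ ∑ x, (if blockOf N M x = b then (g x) ^ 2 else 0) := by
  have hN : (0 : ℝ) < (N : ℝ) ^ (d + 1) := pow_pos (by exact_mod_cast Nat.pos_of_ne_zero (NeZero.ne N)) _
  set S := ∑ y, (if blockOf N M y = b then g y else 0) with hS
  set m : ℝ := ((N : ℝ) ^ (d + 1))⁻¹ * S with hm
  have hpt : ∀ x, (if blockOf N M x = b then ((blockProj N M *ᵥ g) x) ^ 2 else 0) = (if blockOf N M x = b then (1 : ℝ) else 0) * m ^ 2 := by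
    intro x
    by_cases hx : blockOf N M x = b
    · rw [if_pos hx, if_pos hx, one_mul, blockProj_mulVec_eq_mean N M g hx]
    · rw [if_neg hx, if_neg hx, zero_mul]
  rw [Finset.sum_congr rfl fun x _ => hpt x, ← Finset.sum_mul, sum_blockIndicator_eq]
  -- Cauchy–Schwarz: `S² ≤ N^{d+1}·Σ_b g²`
  have hCS : S ^ 2 ≤ (N : ℝ) ^ (d + 1) * ∑ x, (if blockOf N M x = b then (g x) ^ 2 else 0) := by
    have h := Finset.sum_mul_sq_le_sq_mul_sq Finset.univ (fun x => if blockOf N M x = b then (1 : ℝ) else 0)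
      (fun x => if blockOf N M x = b then g x else 0)
    have e1 : ∑ x, (if blockOf N M x = b then (1 : ℝ) else 0) * (if blockOf N M x = b then g x else 0) = S :=
      Finset.sum_congr rfl fun x _ => by by_cases hx : blockOf N M x = b <;> simp [hx]
    have e2 : ∑ x, (if blockOf N M x = b then (1 : ℝ) else 0) ^ 2 = (N : ℝ) ^ (d + 1) := by
      rw [← sum_blockIndicator_eq N M b]
      exact Finset.sum_congr rfl fun x _ => by by_cases hx : blockOf N M x = b <;> simp [hx]
    have e3 : ∑ x, (if blockOf N M x = b then g x else 0) ^ 2 = ∑ x, (if blockOf N M x = b then (g x) ^ 2 else 0) :=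
      Finset.sum_congr rfl fun x _ => by by_cases hx : blockOf N M x = b <;> simp [hx]
    rw [e1, e2, e3] at h
    exact h
  calc (N : ℝ) ^ (d + 1) * m ^ 2 = ((N : ℝ) ^ (d + 1))⁻¹ * S ^ 2 := by rw [hm]; field_simp
    _ ≤ ((N : ℝ) ^ (d + 1))⁻¹ * ((N : ℝ) ^ (d + 1) * ∑ x, (if blockOf N M x = b then (g x) ^ 2 else 0)) :=
        mul_le_mul_of_nonneg_left hCS (by positivity)
    _ = ∑ x, (if blockOf N M x = b then (g x) ^ 2 else 0) := by field_simp

end Blocks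

end Summit.QuantumFields.YangMills.BalabanUVNodes.N15KingModelRung.Curved

end
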